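import Literature.IUT.LogThetaLattice.GlobalLGPFrobenioidsModFrak
import Literature.AlgebraicGeometry.Frobenioids.ArithmeticDivisorsPerfFactorial
import HarnessLib

/-!
# [IUTchIII] Example 3.6 (ii) / Proposition 3.7 (ii): the INTEGRAL divisor monoid of `(†𝓕⊛_𝔪𝔬𝔡)_α` IS [FrdI]
# Example 6.3's `Φ(F)` — hence PERF-FACTORIAL (abc-iut cell, layer L6; sub-row «J1-rlf-bridge» of the
# SUBDAG-IUTchIII-Prop-37 residual J1; written by abc-iut-w4-d015)

S. Mochizuki, *Inter-universal Teichmüller theory III*, kurims manuscript (May 2020), §3, Example 3.6 (ii)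
p. 107 l. 36 – p. 108 l. 10 ("a collection of 'fractional ideals' `𝔍_v ⊆ K_v` for each `v ∈ 𝕍` … such that
`𝔍_v = 𝒪_{K_v}` for all but finitely many `v` … one verifies immediately that [the resulting category]
`†𝓕⊛_𝔪𝔬𝔡` is a Frobenioid") and Proposition 3.7 (ii) p. 110 [claim: Mochizuki2012, status: disputed];
S. Mochizuki, *The geometry of Frobenioids I*, Example 6.3 p. 113: "`Φ(L) := ⊕_{v ∈ V(L)} ord(O_v^▷)` … Thus
[cf. §0], `Φ(L)` is perf-factorial" [cite: MochizukiFrdI2008, Ex. 6.3 p.113] and Prop. 5.3 p. 103 ("Suppose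
that `Φ` is perf-factorial. Then we shall refer to as the realification …") [cite: MochizukiFrdI2008, Prop. 5.3 p.103].

WHY THIS FILE. abc-iut-w4-d005's INTEGRAL datum of a number field `F` for [IUTchIII] Ex. 3.6
(`GlobalLGPFrobenioidsModFrak.lean` §2: `Prop37.Gamma F v = ℝ` at an archimedean and `= ℤ` at a finite place,
cones `Prop37.nonneg F`) gives the fractional-ideal Frobenioid `(†𝓕⊛_𝔪𝔬𝔡)_α = Prop37.Ffrak F` of abc-iut-L6-t6's
`FrakCat`, whose divisor monoid is the monoid of EFFECTIVE families
`GlobalFrobenioidModels.EffDiv (Places F) (Gamma F) (nonneg F)` (`Φmod`). Layer L1 (abc-iut-L1-t3 / L1-d2)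
typed [FrdI] Ex. 6.3's `Φ(F) = EffArithDivisor F = (FinitePlace F →₀ ℕ) × (InfinitePlace F → ℝ_{≥0})` and PROVED
it perf-factorial (`EffArithDivisor.isPerfFactorial`), the hypothesis of [FrdI] Prop. 5.3's realification
(L1-d2 `RealificationData.canonical Φ hΦ`, L5 `FrobenioidRealification.ofModel Φ hΦ Ψ`). The two monoids were
never identified; the typer of record of Prop. 3.7 (abc-iut-L6-t4, 02:31Z) and the realified-Frobenioid holder
(abc-iut-w5-d153, 02:30Z) both name "an `IsPerfFactorial` instance for `EffDiv`" as the blocker of the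
identification J1 of the concrete realification `Prop37.realification` with L1's `PreFrobenioid.realification`.

WHAT IS HERE (data = two explicit additive equivalences; everything else proved):
* `IsPerfFactorial.of_mulEquiv` — [FrdI] Def. 2.4 (i) is invariant under isomorphisms of monoids (the
  transport pattern of L1-d2's `EffArithDivisor.isPerfFactorial`, stated once for all);
* `Prop37.frakObjAddEquivArith : FrakObj (Places F) (Gamma F) ≃+ ArithDivisor F` — the group of ALL
  fractional-ideal families of the integral datum IS `Φ(F)^gp = ⊕_v ord(F_v)`;
* **`Prop37.effDivAddEquivArith : effDiv (Places F) (Gamma F) (nonneg F) ≃+ EffArithDivisor F`** — the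
  EFFECTIVE families ARE `Φ(F)`, compatibly with the two inclusions (`toArithDivisor_effDivAddEquivArith`);
  multiplicative form `Prop37.effDivMulEquivArith`;
* **`Prop37.isPerfFactorial_effDiv : IsPerfFactorial (EffDiv (Places F) (Gamma F) (nonneg F))`** and the
  functor-level form `Prop37.isPerfFactorial_Phimod` (the `hΦ` of `RealificationData.canonical` /
  `FrobenioidRealification.ofModel` for `Φmod`).

NOT HERE (next piece of J1, named): the identification of THE canonical realification
`(RealificationData.canonical (Φmod …) isPerfFactorial_Phimod).rlf` with the REAL divisor monoid over
`(ModelPlaces F, ℝ)` along abc-iut-w4-d005's `realifyObjHom` ([FrdI] Thm. 6.4 (i) "`(Φ^rlf)^gp(L) = ⊕_v ℝ`",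
L1 `ArithmeticDegreeRealification`). Nothing here asserts a disputed claim or takes a side on [IUTchIII]
Cor. 3.12; typed ≠ discharged; instantiated ≠ endorsed.
-/

noncomputable section

/-! ### [FrdI] Def. 2.4 (i) is isomorphism-invariant -/

namespace Literature.AlgebraicGeometry.Frobenioids

universe u

/-- **Perf-factoriality transports along isomorphisms of monoids** ([FrdI] Def. 2.4 (i): every clause —
divisoriality, the monoprime `M_𝔭`, conditions (c)(d) on `M^pf` — is invariant under `M ≅ M'`; the pattern of
`EffArithDivisor.isPerfFactorial`, stated once for all). [cite: MochizukiFrdI2008, Def. 2.4(i) p.47] -/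
theorem IsPerfFactorial.of_mulEquiv {N N' : Type u} [CommMonoid N] [CommMonoid N'] (e : N ≃* N')
    (h : IsPerfFactorial N) : IsPerfFactorial N' :=
  IsPerfFactorial.of_cond (h.isDivisorial.of_mulEquiv e)
    (fun 𝔭' => (h.isMonoprime (Primes.congr e.symm 𝔭')).of_mulEquiv
      (Primes.submonoidCongr e (Primes.congr e.symm 𝔭') 𝔭' (Primes.congr_apply_congr_symm e 𝔭')))
    (Factorization.Cond.of_mulEquiv (Perfection.congr e) h.cond)

end Literature.AlgebraicGeometry.Frobenioids

namespace Literature.IUT.LogThetaLattice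

namespace Prop37

open NumberField GlobalFrobenioidModels Literature.AlgebraicGeometry.Frobenioids

variable (F : Type) [Field F] [NumberField F]

/-! ### The group of fractional-ideal families of the integral datum is `Φ(F)^gp = ⊕_v ord(F_v)` -/

/-- The finite-place coordinates of a family of the integral datum form a finitely supported `ℤ`-valued
function. [cite: MochizukiFrdI2008, Ex. 6.3 p.113] -/
theorem finite_support_inr (J : FrakObj (Places F) (Gamma F)) :
    (Function.support fun w : FinitePlace F => (J.cls (Sum.inr w) : ℤ)).Finite :=
  (J.finite.preimage Sum.inr_injective.injOn).subset fun w (hw : J.cls (Sum.inr w) ≠ 0) => hw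

/-- The family of the integral datum with prescribed coordinates `(N, r)`: classes `r v ∈ ℝ` at the
archimedean and `N w ∈ ℤ` at the finite places (finitely supported since `N` is and there are finitely many
archimedean places). [cite: MochizukiFrdI2008, Ex. 6.3 p.113] -/
def frakObjOfCoords (N : FinitePlace F →₀ ℤ) (r : InfinitePlace F → ℝ) : FrakObj (Places F) (Gamma F) where
  cls
    | .inl v => r v
    | .inr w => N w
  finite := by
    refine ((Set.finite_univ.image (Sum.inl : InfinitePlace F → Places F)).union
      (N.support.finite_toSet.image fun w => (Sum.inr w : Places F))).subset ?_
    rintro (v | w) h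
    · exact Or.inl ⟨v, Set.mem_univ _, rfl⟩
    · exact Or.inr ⟨w, Finset.mem_coe.mpr (Finsupp.mem_support_iff.mpr h), rfl⟩

/-- Coordinates of `frakObjOfCoords` at an archimedean place. [cite: MochizukiFrdI2008, Ex. 6.3 p.113] -/
@[simp] theorem frakObjOfCoords_cls_inl (N : FinitePlace F →₀ ℤ) (r : InfinitePlace F → ℝ)
    (v : InfinitePlace F) : (frakObjOfCoords F N r).cls (Sum.inl v) = r v := rfl

/-- Coordinates of `frakObjOfCoords` at a finite place. [cite: MochizukiFrdI2008, Ex. 6.3 p.113] -/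
@[simp] theorem frakObjOfCoords_cls_inr (N : FinitePlace F →₀ ℤ) (r : InfinitePlace F → ℝ)
    (w : FinitePlace F) : (frakObjOfCoords F N r).cls (Sum.inr w) = N w := rfl

/-- **`(Φ(∗))^gp` of the integral datum IS [FrdI] Ex. 6.3's `Φ(F)^gp = ⊕_{v∈V(F)} ord(F_v)`**: the additive
group of fractional-ideal families `{𝔍_v}_v` of abc-iut-w4-d005's integral datum (`Γ_v = ℤ` resp. `ℝ`) is
layer L1's `ArithDivisor F = (FinitePlace F →₀ ℤ) × (InfinitePlace F → ℝ)`, coordinate by coordinate.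
[cite: MochizukiFrdI2008, Ex. 6.3 p.113] -/
def frakObjAddEquivArith : FrakObj (Places F) (Gamma F) ≃+ ArithDivisor F where
  toFun J := (Finsupp.ofSupportFinite (fun w => (J.cls (Sum.inr w) : ℤ)) (finite_support_inr F J),
    fun v => (J.cls (Sum.inl v) : ℝ))
  invFun d := frakObjOfCoords F d.1 d.2
  left_inv J := FrakObj.ext_cls (funext fun p => by
    rcases p with v | w
    · rfl
    · simp [Finsupp.ofSupportFinite_coe])
  right_inv d := Prod.ext (Finsupp.ext fun w => by simp [Finsupp.ofSupportFinite_coe]) (funext fun v => rfl)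
  map_add' J₁ J₂ := Prod.ext (Finsupp.ext fun w => by simp [Finsupp.ofSupportFinite_coe]) (funext fun v => rfl)

/-- Finite-place coordinate of `frakObjAddEquivArith`. [cite: MochizukiFrdI2008, Ex. 6.3 p.113] -/
@[simp] theorem frakObjAddEquivArith_fst (J : FrakObj (Places F) (Gamma F)) (w : FinitePlace F) :
    (frakObjAddEquivArith F J).1 w = J.cls (Sum.inr w) := by
  simp [frakObjAddEquivArith, Finsupp.ofSupportFinite_coe]

/-- Archimedean coordinate of `frakObjAddEquivArith`. [cite: MochizukiFrdI2008, Ex. 6.3 p.113] -/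
@[simp] theorem frakObjAddEquivArith_snd (J : FrakObj (Places F) (Gamma F)) (v : InfinitePlace F) :
    (frakObjAddEquivArith F J).2 v = J.cls (Sum.inl v) := rfl

/-! ### The effective families ARE `Φ(F) = ⊕_v ord(O_v^▷)` -/

/-- An effective family has nonnegative finite-place coordinates. [cite: MochizukiFrdI2008, Ex. 6.3 p.113] -/
theorem cls_inr_nonneg (D : effDiv (Places F) (Gamma F) (nonneg F)) (w : FinitePlace F) :
    (0 : ℤ) ≤ (D : FrakObj (Places F) (Gamma F)).cls (Sum.inr w) :=
  (mem_nonneg_inr F w _).mp (D.2 (.inr w))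

/-- An effective family has nonnegative archimedean coordinates. [cite: MochizukiFrdI2008, Ex. 6.3 p.113] -/
theorem cls_inl_nonneg (D : effDiv (Places F) (Gamma F) (nonneg F)) (v : InfinitePlace F) :
    (0 : ℝ) ≤ (D : FrakObj (Places F) (Gamma F)).cls (Sum.inl v) :=
  (mem_nonneg_inl F v _).mp (D.2 (.inl v))

/-- The effective family with coordinates an effective arithmetic divisor `(N, r) ∈ Φ(F)`.
[cite: MochizukiFrdI2008, Ex. 6.3 p.113] -/
def effDivOfArith (E : EffArithDivisor F) : effDiv (Places F) (Gamma F) (nonneg F) :=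
  ⟨frakObjOfCoords F (E.1.mapRange (fun n : ℕ => (n : ℤ)) (by simp)) (fun v => (E.2 v : ℝ)), by
    rintro (v | w)
    · exact (mem_nonneg_inl F v _).mpr (E.2 v).2
    · exact (mem_nonneg_inr F w _).mpr (by simp)⟩

/-- Coordinates of `effDivOfArith` at a finite place. [cite: MochizukiFrdI2008, Ex. 6.3 p.113] -/
@[simp] theorem effDivOfArith_cls_inr (E : EffArithDivisor F) (w : FinitePlace F) :
    (effDivOfArith F E : FrakObj (Places F) (Gamma F)).cls (Sum.inr w) = (E.1 w : ℤ) := by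
  simp [effDivOfArith]

/-- Coordinates of `effDivOfArith` at an archimedean place. [cite: MochizukiFrdI2008, Ex. 6.3 p.113] -/
@[simp] theorem effDivOfArith_cls_inl (E : EffArithDivisor F) (v : InfinitePlace F) :
    (effDivOfArith F E : FrakObj (Places F) (Gamma F)).cls (Sum.inl v) = (E.2 v : ℝ) := rfl

/-- The support of the `ℕ`-valued finite-place coordinates of an effective family is finite.
[cite: MochizukiFrdI2008, Ex. 6.3 p.113] -/
theorem finite_support_toNat (D : effDiv (Places F) (Gamma F) (nonneg F)) :
    (Function.support fun w : FinitePlace F =>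
      ((D : FrakObj (Places F) (Gamma F)).cls (Sum.inr w)).toNat).Finite := by
  refine (finite_support_inr F D).subset fun w hw => ?_
  rw [Function.mem_support] at hw ⊢
  intro h0
  exact hw (by rw [h0, Int.toNat_zero])

/-- The forward map `Φ(∗) → Φ(F)`: `ℕ`-valued finite coordinates (`toNat` of the nonnegative integer class) and
`ℝ_{≥0}`-valued archimedean coordinates. [cite: MochizukiFrdI2008, Ex. 6.3 p.113] -/
def effDivToArith (D : effDiv (Places F) (Gamma F) (nonneg F)) : EffArithDivisor F :=
  (Finsupp.ofSupportFinite _ (finite_support_toNat F D),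
    fun v => ⟨(D : FrakObj (Places F) (Gamma F)).cls (Sum.inl v), cls_inl_nonneg F D v⟩)

/-- Finite-place coordinate of `effDivToArith` (as an integer: the class itself).
[cite: MochizukiFrdI2008, Ex. 6.3 p.113] -/
@[simp] theorem effDivToArith_fst_cast (D : effDiv (Places F) (Gamma F) (nonneg F)) (w : FinitePlace F) :
    (((effDivToArith F D).1 w : ℕ) : ℤ) = (D : FrakObj (Places F) (Gamma F)).cls (Sum.inr w) := by
  show ((((D : FrakObj (Places F) (Gamma F)).cls (Sum.inr w)).toNat : ℕ) : ℤ) = _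
  exact Int.toNat_of_nonneg (cls_inr_nonneg F D w)

/-- Finite-place coordinate of `effDivToArith`, `ℕ`-valued. [cite: MochizukiFrdI2008, Ex. 6.3 p.113] -/
theorem effDivToArith_fst (D : effDiv (Places F) (Gamma F) (nonneg F)) (w : FinitePlace F) :
    (effDivToArith F D).1 w = ((D : FrakObj (Places F) (Gamma F)).cls (Sum.inr w)).toNat := rfl

/-- Archimedean coordinate of `effDivToArith`. [cite: MochizukiFrdI2008, Ex. 6.3 p.113] -/
@[simp] theorem effDivToArith_snd_coe (D : effDiv (Places F) (Gamma F) (nonneg F)) (v : InfinitePlace F) :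
    ((effDivToArith F D).2 v : ℝ) = (D : FrakObj (Places F) (Gamma F)).cls (Sum.inl v) := rfl

/-- **`Φ(∗)` of the integral datum IS [FrdI] Ex. 6.3's `Φ(F) = ⊕_{v∈V(F)} ord(O_v^▷)`**: the monoid of EFFECTIVE
fractional-ideal families of abc-iut-w4-d005's integral datum (`Γ_v^{≥0} = ℤ_{≥0}` resp. `ℝ_{≥0}`) is layer L1's
`EffArithDivisor F = (FinitePlace F →₀ ℕ) × (InfinitePlace F → ℝ_{≥0})`, coordinate by coordinate.
[cite: MochizukiFrdI2008, Ex. 6.3 p.113] -/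
def effDivAddEquivArith : effDiv (Places F) (Gamma F) (nonneg F) ≃+ EffArithDivisor F where
  toFun := effDivToArith F
  invFun := effDivOfArith F
  left_inv D := Subtype.ext (FrakObj.ext_cls (funext fun p => by
    rcases p with v | w
    · rfl
    · rw [effDivOfArith_cls_inr, effDivToArith_fst_cast]))
  right_inv E := Prod.ext
    (Finsupp.ext fun w => by
      have h := effDivToArith_fst_cast F (effDivOfArith F E) w
      rw [effDivOfArith_cls_inr] at h
      exact_mod_cast h)
    (funext fun v => NNReal.eq rfl)
  map_add' D₁ D₂ := Prod.ext
    (Finsupp.ext fun w => by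
      rw [Prod.fst_add, Finsupp.add_apply]
      have h := effDivToArith_fst_cast F (D₁ + D₂) w
      rw [AddSubmonoid.coe_add, FrakObj.cls_add, ← effDivToArith_fst_cast F D₁ w, ← effDivToArith_fst_cast F D₂ w,
        ← Nat.cast_add] at h
      exact_mod_cast h)
    (funext fun v => NNReal.eq (by
      rw [Prod.snd_add, Pi.add_apply, NNReal.coe_add, effDivToArith_snd_coe, effDivToArith_snd_coe,
        effDivToArith_snd_coe, AddSubmonoid.coe_add, FrakObj.cls_add]))

/-- `effDivAddEquivArith` is `effDivToArith`. [cite: MochizukiFrdI2008, Ex. 6.3 p.113] -/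
@[simp] theorem effDivAddEquivArith_apply (D : effDiv (Places F) (Gamma F) (nonneg F)) :
    effDivAddEquivArith F D = effDivToArith F D := rfl

/-- `effDivAddEquivArith.symm` is `effDivOfArith`. [cite: MochizukiFrdI2008, Ex. 6.3 p.113] -/
@[simp] theorem effDivAddEquivArith_symm_apply (E : EffArithDivisor F) :
    (effDivAddEquivArith F).symm E = effDivOfArith F E := rfl

/-- **Compatibility of the two identifications with the inclusions `Φ ⊆ Φ^gp`**: L1's
`EffArithDivisor.toArithDivisor ∘ effDivAddEquivArith = frakObjAddEquivArith ∘ (effDiv ⊆ FrakObj)`.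
[cite: MochizukiFrdI2008, Ex. 6.3 p.113] -/
theorem toArithDivisor_effDivAddEquivArith (D : effDiv (Places F) (Gamma F) (nonneg F)) :
    EffArithDivisor.toArithDivisor F (effDivAddEquivArith F D) =
      frakObjAddEquivArith F (D : FrakObj (Places F) (Gamma F)) :=
  Prod.ext (Finsupp.ext fun w => by
      rw [effDivAddEquivArith_apply, EffArithDivisor.toArithDivisor_fst, effDivToArith_fst_cast,
        frakObjAddEquivArith_fst])
    (funext fun v => by
      rw [effDivAddEquivArith_apply, EffArithDivisor.toArithDivisor_snd, effDivToArith_snd_coe,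
        frakObjAddEquivArith_snd])

/-- `Φ(∗) ≅ Φ(F)` in the MULTIPLICATIVE rendering of layer L1 (`EffDiv = Multiplicative (effDiv …)` vs
`Multiplicative (EffArithDivisor F)`). [cite: MochizukiFrdI2008, Ex. 6.3 p.113] -/
def effDivMulEquivArith : EffDiv (Places F) (Gamma F) (nonneg F) ≃* Multiplicative (EffArithDivisor F) :=
  AddEquiv.toMultiplicative (effDivAddEquivArith F)

/-! ### Hence `Φ(∗)` is perf-factorial: the hypothesis of [FrdI] Prop. 5.3's realification -/

/-- **The divisor monoid `Φ(∗)` of `(†𝓕⊛_𝔪𝔬𝔡)_α` (integral datum) is PERF-FACTORIAL** — [FrdI] Ex. 6.3 "`Φ(L)` is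
perf-factorial", transported from layer L1's `EffArithDivisor.isPerfFactorial` along `effDivMulEquivArith`.
This is the `IsPerfFactorial` input of [FrdI] Prop. 5.3 (the realification `C^rlf`) for `(†𝓕⊛_𝔪𝔬𝔡)_α`.
[cite: MochizukiFrdI2008, Ex. 6.3 p.113] -/
theorem isPerfFactorial_effDiv : IsPerfFactorial (EffDiv (Places F) (Gamma F) (nonneg F)) :=
  (EffArithDivisor.isPerfFactorial F).of_mulEquiv (effDivMulEquivArith F).symm

/-- **Functor-level form**: every value of the divisor-monoid functor `Φmod` of `(†𝓕⊛_𝔪𝔬𝔡)_α` over the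
one-morphism base is perf-factorial — literally the hypothesis `hΦ` of layer L1's `RealificationData.canonical Φ hΦ`
and of `Literature.IUT.HodgeTheaters.FrobenioidRealification.ofModel Φ hΦ Ψ` ([FrdI] Prop. 5.3) at
`Φ := Φmod (Places F) (Gamma F) (nonneg F)`. [cite: MochizukiFrdI2008, Prop. 5.3 p.103] -/
theorem isPerfFactorial_Phimod (X : Base.{0}ᵒᵖ) :
    IsPerfFactorial ((Φmod (Places F) (Gamma F) (nonneg F)).obj X) :=
  isPerfFactorial_effDiv F

end Prop37

end Literature.IUT.LogThetaLattice

end
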